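import Mathlib.FieldTheory.Normal.Closure
import Literature.NumberTheory.GaloisRepresentations.KummerLayerTransfer
import Literature.FieldTheory.Galois.SolvableCompositum
import HarnessLib

/-!
# The solvable tower engine: soluble extensions with prescribed local containment

Topic `NumberTheory/GaloisRepresentations`; theorems only (no definition, no named fact).  The
class-field-theory-free replacement for the first step of Clozel–Harris–Taylor, Lemma 4.1.2
(existence of a soluble totally real / CM extension with prescribed local behaviour): for a number
field `K`, a finite set `S` of finite places with open normal subgroups `N_v ≤ Γ_{K_v}` (`v ∈ S`)
and a finite set `V` of places disjoint from `S`, there is a finite Galois extension `E ⊆ K̄` of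
`K` with **solvable** Galois group such that the local group `{σ ∈ Γ_{K_v} | σ fixes ι_v E}` is
contained in `N_v` for `v ∈ S`, `E` is split at every `u ∈ V`, and `E` is totally real if `K` is
(`exists_isSolvable_forall_localGroup_le`).  Proof: iterate `KummerLayerRound.exists_layer`,
replacing the current field `k` by the normal closure of the layer `M`; the measure
`∑_{v ∈ S} [H_v(k) : H_v(k) ⊓ N_v]` strictly drops.

The general lemmas of the first section (solvability in a tower of Galois extensions, conjugate
layers, total reality of composita) are folklore.

## References

* L. Clozel, M. Harris, R. Taylor, *Automorphy for some l-adic lifts of automorphic mod l Galois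
  representations*, Publ. Math. IHÉS 108 (2008), Lemma 4.1.2 (statement being replaced).
  [cite: ClozelHarrisTaylor2008, Lemma 4.1.2]
* H. Cohen, P. Stevenhagen, *Computational class field theory*, MSRI Publ. 44 (2008), §5.
  [cite: BuhlerStevenhagen2008, §5 p. 532]
-/

noncomputable section

open scoped NumberField IntermediateField Valued ComplexConjugate
open Field IsDedekindDomain IntermediateField
open Literature.FieldTheory.Kummer Literature.FieldTheory.Galois

universe u

namespace Literature.NumberTheory.GaloisRepresentations

/-! ### General lemmas -/

section General

variable {F L : Type*} [Field F] [Field L] [Algebra F L]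

/-- **Solvability in a tower.**  `Gal(E/F)` is solvable when `Gal(k/F)` and `Gal(E/k)` are, for
`F ⊆ k ⊆ E ⊆ L` with `k/F` normal (`1 → Gal(E/k) → Gal(E/F) → Gal(k/F)`). [folklore] -/
theorem isSolvable_algEquiv_restrictScalars (k : IntermediateField F L) [Normal F k]
    (E : IntermediateField (↥k) L) [IsSolvable (k ≃ₐ[F] k)] [IsSolvable (E ≃ₐ[↥k] E)] :
    IsSolvable ((E.restrictScalars F) ≃ₐ[F] (E.restrictScalars F)) := by
  letI : Algebra (↥k) ↥(E.restrictScalars F) := E.algebra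
  haveI : IsScalarTower F (↥k) ↥(E.restrictScalars F) := IntermediateField.isScalarTower E
  let f : (E ≃ₐ[↥k] E) →* ((E.restrictScalars F) ≃ₐ[F] (E.restrictScalars F)) :=
    { toFun := fun φ => (φ.restrictScalars F : E ≃ₐ[F] E)
      map_one' := by ext; rfl
      map_mul' := fun _ _ => by ext; rfl }
  let g : ((E.restrictScalars F) ≃ₐ[F] (E.restrictScalars F)) →* (k ≃ₐ[F] k) :=
    AlgEquiv.restrictNormalHom (↥k)
  refine solvable_of_ker_le_range f g fun σ hσ => ?_
  rw [MonoidHom.mem_ker] at hσ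
  have hfix : ∀ x : ↥k, σ (algebraMap (↥k) ↥(E.restrictScalars F) x) =
      algebraMap (↥k) ↥(E.restrictScalars F) x := by
    intro x
    have h1 := AlgEquiv.restrictNormal_commutes σ (↥k) x
    change algebraMap (↥k) ↥(E.restrictScalars F) (g σ x) = _ at h1
    rw [hσ, AlgEquiv.one_apply] at h1
    exact h1.symm
  exact ⟨{ σ with commutes' := hfix }, by ext; rfl⟩

/-- A group of prime order is solvable. [folklore] -/
theorem isSolvable_of_card_prime {G : Type*} [Group G] {p : ℕ} [hp : Fact p.Prime]
    (h : Nat.card G = p) : IsSolvable G := by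
  haveI : IsCyclic G := isCyclic_of_prime_card h
  obtain ⟨g, hg⟩ := IsCyclic.exists_generator (α := G)
  refine isSolvable_of_comm fun a b => ?_
  obtain ⟨i, rfl⟩ := hg a
  obtain ⟨j, rfl⟩ := hg b
  rw [← zpow_add, ← zpow_add, add_comm]

/-- `k ≤ γ(M)` for `k/F` normal, `M ⊇ k`, `γ ∈ Aut(L/F)`. [folklore] -/
theorem le_map_restrictScalars [Normal F L] (k : IntermediateField F L) [Normal F k]
    (M : IntermediateField (↥k) L) (γ : L ≃ₐ[F] L) :
    k ≤ (M.restrictScalars F).map (γ : L →ₐ[F] L) := by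
  intro x hx
  have h1 : γ.symm x ∈ k :=
    (IntermediateField.normal_iff_forall_map_le'.1 (inferInstance : Normal F k)) γ.symm ⟨x, hx, rfl⟩
  exact ⟨γ.symm x, IntermediateField.algebraMap_mem M (⟨_, h1⟩ : k), by simp⟩

/-- The conjugate layer `γ(M)` is normal over `k` when `M/k` is and `k/F` is normal.
[folklore] -/
theorem normal_extendScalars_map [Normal F L] (k : IntermediateField F L) [Normal F k]
    (M : IntermediateField (↥k) L) [Normal (↥k) M] (γ : L ≃ₐ[F] L) :
    Normal (↥k) (extendScalars (le_map_restrictScalars k M γ)) := by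
  rw [IntermediateField.normal_iff_forall_map_le']
  intro τ y hy
  obtain ⟨x, hx, rfl⟩ := hy
  change x ∈ (M.restrictScalars F).map (γ : L →ₐ[F] L) at hx
  obtain ⟨m, hm, rfl⟩ := hx
  change m ∈ M at hm
  change (τ : L →ₐ[↥k] L) (γ m) ∈ (M.restrictScalars F).map (γ : L →ₐ[F] L)
  -- `γ⁻¹ τ γ` is `k`-linear
  have hτ'k : ∀ z ∈ k, (γ.trans ((τ.restrictScalars F).trans γ.symm)) z = z := by
    intro z hz
    simp only [AlgEquiv.trans_apply, AlgEquiv.restrictScalars_apply]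
    have h1 : γ z ∈ k :=
      (IntermediateField.normal_iff_forall_map_le'.1 (inferInstance : Normal F k)) γ ⟨z, hz, rfl⟩
    have h2 : τ (γ z) = γ z := τ.commutes (⟨γ z, h1⟩ : k)
    rw [h2, AlgEquiv.symm_apply_apply]
  let τ₀ : L ≃ₐ[↥k] L :=
    { (γ.trans ((τ.restrictScalars F).trans γ.symm)) with commutes' := fun z => hτ'k z z.2 }
  have hτ₀ : ∀ z : L, τ₀ z = γ.symm (τ (γ z)) := fun z => rfl
  have hm' : τ₀ m ∈ M :=
    (IntermediateField.normal_iff_forall_map_le'.1 (inferInstance : Normal (↥k) M)) τ₀ ⟨m, hm, rfl⟩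
  refine ⟨τ₀ m, hm', ?_⟩
  rw [hτ₀]
  exact γ.apply_symm_apply _

/-- `[γ(M) : k] = [M : k]`. [folklore] -/
theorem finrank_extendScalars_map [Normal F L] (k : IntermediateField F L) [Normal F k]
    [FiniteDimensional F k]
    (M : IntermediateField (↥k) L) (γ : L ≃ₐ[F] L) :
    Module.finrank (↥k) (extendScalars (le_map_restrictScalars k M γ)) = Module.finrank (↥k) M := by
  have h1 : Module.finrank F ((M.restrictScalars F).map (γ : L →ₐ[F] L)) =
      Module.finrank F (M.restrictScalars F) :=
    (IntermediateField.equivMap (M.restrictScalars F) (γ : L →ₐ[F] L)).toLinearEquiv.finrank_eq.symm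
  have h2 := Module.finrank_mul_finrank F (↥k) (extendScalars (le_map_restrictScalars k M γ))
  have h3 := Module.finrank_mul_finrank F (↥k) M
  have h4 : Module.finrank F (extendScalars (le_map_restrictScalars k M γ)) =
      Module.finrank F ((M.restrictScalars F).map (γ : L →ₐ[F] L)) := rfl
  have h5 : Module.finrank F M = Module.finrank F (M.restrictScalars F) := rfl
  rw [h4, h1, ← h5, ← h3] at h2
  exact Nat.eq_of_mul_eq_mul_left Module.finrank_pos h2

/-- `(⨆ᵢ Xᵢ).restrictScalars F = ⨆ᵢ (Xᵢ.restrictScalars F)` for a nonempty family of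
intermediate fields of `L/k`. [folklore] -/
theorem restrictScalars_iSup {ι : Type*} [Nonempty ι] (k : IntermediateField F L)
    (X : ι → IntermediateField (↥k) L) :
    (⨆ i, X i).restrictScalars F = ⨆ i, (X i).restrictScalars F := by
  apply le_antisymm
  · rw [← (IntermediateField.gi (F := ↥k) (E := L)).l_iSup_u,
      IntermediateField.restrictScalars_adjoin, IntermediateField.adjoin_le_iff]
    rintro x (hx | hx)
    · obtain ⟨i⟩ := ‹Nonempty ι›
      exact (le_iSup (fun i => (X i).restrictScalars F) i)
        (IntermediateField.algebraMap_mem (X i) (⟨x, hx⟩ : k))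
    · obtain ⟨i, hxi⟩ := Set.mem_iUnion.1 hx
      exact (le_iSup (fun i => (X i).restrictScalars F) i) hxi
  · exact iSup_le fun i => fun x hx => (le_iSup X i : X i ≤ ⨆ i, X i) hx

end General

/-! ### Lemmas in the number-field setting -/

section Engine

variable (K : Type u) [Field K] [NumberField K]

/-- Membership in the local group `{σ ∈ Γ_{K_v} | σ fixes ι_v E}` written as a preimage of
`Gal(K̄/E)`. [folklore] -/
theorem mem_comap_comap_fixingSubgroup_iff (v : HeightOneSpectrum (𝓞 K))
    (E : IntermediateField K (AlgebraicClosure K)) (σ : absoluteGaloisGroup (v.adicCompletion K)) :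
    σ ∈ ((E.fixingSubgroup.comap (absoluteGaloisGroup.toAlgEquiv K).toMonoidHom).comap
      (absGaloisRestrict K (v.adicCompletion K)).toMonoidHom) ↔
      ∀ x ∈ E, σ • absClosureEmbedding K (v.adicCompletion K) x =
        absClosureEmbedding K (v.adicCompletion K) x := by
  rw [Subgroup.mem_comap, Subgroup.mem_comap, forall_smul_absClosureEmbedding_eq_iff]
  exact absGaloisRestrict_mem_fixingSubgroup_iff K v E σ

/-- An embedding `M → K̄` over `K` of a subfield `M ⊆ K̄` extends to an element of `Γ_K`.
[folklore] -/
theorem exists_smul_eq_algHom (M : IntermediateField K (AlgebraicClosure K))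
    (f : M →ₐ[K] AlgebraicClosure K) :
    ∃ γ : absoluteGaloisGroup K, ∀ m : M, γ • (m : AlgebraicClosure K) = f m := by
  have hbij := AlgHom.normal_bijective K (AlgebraicClosure K) (AlgebraicClosure K)
    (f.liftNormal (AlgebraicClosure K))
  refine ⟨(absoluteGaloisGroup.toAlgEquiv K).symm (AlgEquiv.ofBijective _ hbij), fun m => ?_⟩
  change f.liftNormal (AlgebraicClosure K) (m : AlgebraicClosure K) = f m
  exact f.liftNormal_commutes (AlgebraicClosure K) m

omit [NumberField K] in
/-- Total reality is transported to a conjugate subfield. [folklore] -/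
theorem isReal_map_of_isReal (M : IntermediateField K (AlgebraicClosure K))
    (γ : AlgebraicClosure K →ₐ[K] AlgebraicClosure K)
    (h : ∀ φ : M →+* ℂ, NumberField.ComplexEmbedding.IsReal φ) (ψ : (M.map γ) →+* ℂ) :
    NumberField.ComplexEmbedding.IsReal ψ := by
  rw [NumberField.ComplexEmbedding.isReal_iff]
  ext y
  obtain ⟨m, rfl⟩ := (IntermediateField.equivMap M γ).surjective y
  have h1 := h (ψ.comp (IntermediateField.equivMap M γ).toRingEquiv.toRingHom)
  rw [NumberField.ComplexEmbedding.isReal_iff] at h1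
  exact RingHom.congr_fun h1 m

omit [NumberField K] in
/-- A compositum of totally real subfields is totally real (when `K` is). [folklore] -/
theorem isReal_iSup {ι : Type*} (X : ι → IntermediateField K (AlgebraicClosure K))
    (hK : ∀ φ : K →+* ℂ, NumberField.ComplexEmbedding.IsReal φ)
    (h : ∀ i, ∀ φ : (X i) →+* ℂ, NumberField.ComplexEmbedding.IsReal φ)
    (φ : (⨆ i, X i : IntermediateField K (AlgebraicClosure K)) →+* ℂ) :
    NumberField.ComplexEmbedding.IsReal φ := by
  letI : Algebra K ℂ := (φ.comp (algebraMap K _)).toAlgebra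
  have hreal : ∀ c : K, conj (φ (algebraMap K _ c)) = φ (algebraMap K _ c) := fun c => by
    have h1 := hK (φ.comp (algebraMap K _))
    rw [NumberField.ComplexEmbedding.isReal_iff] at h1
    exact RingHom.congr_fun h1 c
  let φ₁ : (⨆ i, X i : IntermediateField K (AlgebraicClosure K)) →ₐ[K] ℂ :=
    { (starRingEnd ℂ).comp φ with commutes' := fun c => hreal c }
  let φ₂ : (⨆ i, X i : IntermediateField K (AlgebraicClosure K)) →ₐ[K] ℂ :=
    { φ with commutes' := fun _ => rfl }
  have hS : (⨆ i, X i : IntermediateField K (AlgebraicClosure K)) =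
      IntermediateField.adjoin K (⋃ i, (X i : Set (AlgebraicClosure K))) :=
    ((IntermediateField.gi (F := K) (E := AlgebraicClosure K)).l_iSup_u X).symm
  have hφ : φ₁ = φ₂ := by
    refine IntermediateField.algHom_ext_of_eq_adjoin K hS fun x hx => ?_
    obtain ⟨i, hxi⟩ := Set.mem_iUnion.1 hx
    have h1 := h i (φ.comp (IntermediateField.inclusion (le_iSup X i)))
    rw [NumberField.ComplexEmbedding.isReal_iff] at h1
    exact RingHom.congr_fun h1 ⟨x, hxi⟩
  rw [NumberField.ComplexEmbedding.isReal_iff]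
  ext x
  exact AlgHom.congr_fun hφ x

/-- A finite nonempty compositum of finite Galois extensions with solvable Galois groups is finite
Galois with solvable Galois group. [folklore] -/
theorem finiteDimensional_isGalois_isSolvable_iSup {F' L' : Type*} [Field F'] [Field L']
    [Algebra F' L'] {ι : Type*} [Fintype ι] [Nonempty ι] (X : ι → IntermediateField F' L')
    [∀ i, FiniteDimensional F' (X i)] [∀ i, IsGalois F' (X i)]
    (h : ∀ i, IsSolvable ((X i) ≃ₐ[F'] (X i))) :
    FiniteDimensional F' (⨆ i, X i : IntermediateField F' L') ∧
      IsGalois F' (⨆ i, X i : IntermediateField F' L') ∧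
      IsSolvable ((⨆ i, X i : IntermediateField F' L') ≃ₐ[F'] (⨆ i, X i : IntermediateField F' L')) := by
  classical
  have key : ∀ s : Finset ι, s.Nonempty →
      FiniteDimensional F' (s.sup X : IntermediateField F' L') ∧
      IsGalois F' (s.sup X : IntermediateField F' L') ∧
      IsSolvable ((s.sup X : IntermediateField F' L') ≃ₐ[F'] (s.sup X : IntermediateField F' L')) := by
    intro s hs
    induction hs using Finset.Nonempty.cons_induction with
    | singleton i =>
        rw [Finset.sup_singleton]
        exact ⟨inferInstance, inferInstance, h i⟩
    | cons i s hi hs ih =>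
        obtain ⟨h1, h2, h3⟩ := ih
        rw [Finset.sup_cons]
        haveI := h1
        haveI := h2
        haveI := h3
        haveI := h i
        exact isGalois_and_isSolvable_sup (X i) (s.sup X)
  have hmain := key Finset.univ Finset.univ_nonempty
  rwa [Finset.sup_univ_eq_iSup] at hmain

/-! ### The engine -/

set_option maxHeartbeats 800000 in
/-- **Soluble extensions with prescribed local containment, split at `V`, totally real if `K`
is** — the class-field-theory-free form of the extension step in Clozel–Harris–Taylor,
Lemma 4.1.2, proved by iterating Hecke–Kummer rounds.
[cite: ClozelHarrisTaylor2008, Lemma 4.1.2] [cite: BuhlerStevenhagen2008, §5 p. 532] -/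
theorem exists_isSolvable_forall_localGroup_le (S : Finset (HeightOneSpectrum (𝓞 K)))
    (N : (v : HeightOneSpectrum (𝓞 K)) → Subgroup (absoluteGaloisGroup (v.adicCompletion K)))
    (hNn : ∀ v ∈ S, (N v).Normal)
    (hNo : ∀ v ∈ S, IsOpen (N v : Set (absoluteGaloisGroup (v.adicCompletion K))))
    (V : Finset (HeightOneSpectrum (𝓞 K))) (hSV : Disjoint S V) :
    ∃ E : IntermediateField K (AlgebraicClosure K), FiniteDimensional K E ∧ IsGalois K E ∧
      IsSolvable (E ≃ₐ[K] E) ∧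
      (∀ v ∈ S, ∀ σ : absoluteGaloisGroup (v.adicCompletion K),
        (∀ x ∈ E, σ • absClosureEmbedding K (v.adicCompletion K) x =
          absClosureEmbedding K (v.adicCompletion K) x) → σ ∈ N v) ∧
      (∀ u ∈ V, ∀ σ : absoluteGaloisGroup (u.adicCompletion K), ∀ x ∈ E,
        σ • absClosureEmbedding K (u.adicCompletion K) x =
          absClosureEmbedding K (u.adicCompletion K) x) ∧
      ((∀ φ : K →+* ℂ, NumberField.ComplexEmbedding.IsReal φ) →
        ∀ φ : E →+* ℂ, NumberField.ComplexEmbedding.IsReal φ) := by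
  classical
  -- local groups and the measure
  let Hloc : (v : HeightOneSpectrum (𝓞 K)) → IntermediateField K (AlgebraicClosure K) →
      Subgroup (absoluteGaloisGroup (v.adicCompletion K)) := fun v E =>
    (E.fixingSubgroup.comap (absoluteGaloisGroup.toAlgEquiv K).toMonoidHom).comap
      (absGaloisRestrict K (v.adicCompletion K)).toMonoidHom
  have hHloc : ∀ v E σ, σ ∈ Hloc v E ↔ ∀ x ∈ E, σ • absClosureEmbedding K (v.adicCompletion K) x =
      absClosureEmbedding K (v.adicCompletion K) x := fun v E σ =>
    mem_comap_comap_fixingSubgroup_iff K v E σ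
  let μ : IntermediateField K (AlgebraicClosure K) → ℕ := fun E =>
    ∑ v ∈ S, (N v).relIndex (Hloc v E)
  have hfin : ∀ v ∈ S, ∀ E, (N v).relIndex (Hloc v E) ≠ 0 := by
    intro v hv E
    haveI := hNn v hv
    haveI := finite_quotient_of_isOpen (v.adicCompletion K) (N v) (hNo v hv)
    exact fun h0 => Subgroup.index_ne_zero_of_finite
      (Subgroup.index_eq_zero_of_relIndex_eq_zero h0)
  -- the inductive claim
  suffices key : ∀ (n : ℕ) (k : IntermediateField K (AlgebraicClosure K)) [FiniteDimensional K k]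
      [IsGalois K k], IsSolvable (k ≃ₐ[K] k) →
      (∀ u ∈ V, ∀ σ : absoluteGaloisGroup (u.adicCompletion K), ∀ x ∈ k,
        σ • absClosureEmbedding K (u.adicCompletion K) x =
          absClosureEmbedding K (u.adicCompletion K) x) →
      ((∀ φ : K →+* ℂ, NumberField.ComplexEmbedding.IsReal φ) →
        ∀ φ : k →+* ℂ, NumberField.ComplexEmbedding.IsReal φ) → μ k = n →
      ∃ E : IntermediateField K (AlgebraicClosure K), FiniteDimensional K E ∧ IsGalois K E ∧
        IsSolvable (E ≃ₐ[K] E) ∧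
        (∀ v ∈ S, ∀ σ : absoluteGaloisGroup (v.adicCompletion K),
          (∀ x ∈ E, σ • absClosureEmbedding K (v.adicCompletion K) x =
            absClosureEmbedding K (v.adicCompletion K) x) → σ ∈ N v) ∧
        (∀ u ∈ V, ∀ σ : absoluteGaloisGroup (u.adicCompletion K), ∀ x ∈ E,
          σ • absClosureEmbedding K (u.adicCompletion K) x =
            absClosureEmbedding K (u.adicCompletion K) x) ∧
        ((∀ φ : K →+* ℂ, NumberField.ComplexEmbedding.IsReal φ) →
          ∀ φ : E →+* ℂ, NumberField.ComplexEmbedding.IsReal φ) by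
    -- start at `k = ⊥`
    haveI : IsGalois K (⊥ : IntermediateField K (AlgebraicClosure K)) :=
      IsGalois.of_algEquiv (IntermediateField.botEquiv K (AlgebraicClosure K)).symm
    have hbot : ∀ x : (⊥ : IntermediateField K (AlgebraicClosure K)), ∃ c : K,
        x = algebraMap K _ c := fun x => by
      obtain ⟨c, hc⟩ := IntermediateField.mem_bot.1 x.2
      exact ⟨c, Subtype.ext hc.symm⟩
    refine key (μ ⊥) ⊥ ?_ ?_ ?_ rfl
    · refine isSolvable_of_comm fun a b => ?_
      have hall : ∀ e : (⊥ : IntermediateField K (AlgebraicClosure K)) ≃ₐ[K]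
          (⊥ : IntermediateField K (AlgebraicClosure K)), e = 1 := fun e =>
        AlgEquiv.ext fun x => by
          obtain ⟨c, rfl⟩ := hbot x
          rw [AlgEquiv.one_apply, AlgEquiv.commutes]
      rw [hall a, hall b]
    · intro u _ σ x hx
      obtain ⟨c, hc⟩ := IntermediateField.mem_bot.1 hx
      rw [← hc, AlgHom.commutes, IsScalarTower.algebraMap_apply K (u.adicCompletion K)
        (AlgebraicClosure (u.adicCompletion K)), absoluteGaloisGroup.smul_def, AlgEquiv.commutes]
    · intro hK φ
      rw [NumberField.ComplexEmbedding.isReal_iff]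
      ext x
      obtain ⟨c, rfl⟩ := hbot x
      have h1 := hK (φ.comp (algebraMap K _))
      rw [NumberField.ComplexEmbedding.isReal_iff] at h1
      exact RingHom.congr_fun h1 c
  intro n
  induction n using Nat.strong_induction_on with
  | _ n ih => ?_
  intro k _ _ hsolv hsplit hTR hμ
  by_cases hdone : ∀ v ∈ S, Hloc v k ≤ N v
  · exact ⟨k, inferInstance, inferInstance, hsolv,
      fun v hv σ hσ => hdone v hv ((hHloc v k σ).2 hσ), hsplit, hTR⟩
  -- a round at a bad place `v₀`
  obtain ⟨v₀, hv₀, hnot⟩ : ∃ v₀ ∈ S, ¬ Hloc v₀ k ≤ N v₀ := by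
    by_contra hcon
    exact hdone fun v hv => by_contra fun h' => hcon ⟨v, hv, h'⟩
  haveI := hNn v₀ hv₀
  have hV : v₀ ∉ V := fun h => Finset.disjoint_left.1 hSV hv₀ h
  obtain ⟨ℓ, ζg, α, M, hℓ, hζg, hMle, hMsup, hMfin, hMgal, hMrank,
      ⟨H', -, hH'mem, hmeas, hne⟩, hC3, ⟨hA, hpos⟩⟩ :=
    exists_layer K v₀ k (N v₀) (hNo v₀ hv₀) (hHloc v₀ k) hnot V hV hsplit
  haveI := hMfin
  haveI := hMgal
  haveI : Fact ℓ.Prime := ⟨hℓ⟩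
  -- the conjugate layers
  set MK : IntermediateField K (AlgebraicClosure K) := M.restrictScalars K with hMK
  haveI : FiniteDimensional K MK := (Module.Finite.trans (R := K) (↥k) (↥M) : Module.Finite K (↥M))
  have hγ : ∀ f : MK →ₐ[K] AlgebraicClosure K, ∃ γ : absoluteGaloisGroup K,
      ∀ m : MK, γ • (m : AlgebraicClosure K) = f m := fun f => exists_smul_eq_algHom K MK f
  choose γ hγ using hγ
  let C : (MK →ₐ[K] AlgebraicClosure K) → IntermediateField (↥k) (AlgebraicClosure K) := fun f =>
    extendScalars (le_map_restrictScalars k M (absoluteGaloisGroup.toAlgEquiv K (γ f)))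
  have hCnormal : ∀ f, Normal (↥k) (C f) := fun f => normal_extendScalars_map k M _
  have hCrank : ∀ f, Module.finrank (↥k) (C f) = ℓ := fun f =>
    (finrank_extendScalars_map k M _).trans hMrank
  haveI hCfin : ∀ f, FiniteDimensional (↥k) (C f) := fun f =>
    Module.finite_of_finrank_pos (by rw [hCrank]; exact hℓ.pos)
  haveI hCgal : ∀ f, IsGalois (↥k) (C f) := fun f => by
    haveI : Algebra.IsSeparable (↥k) (C f) := Algebra.IsAlgebraic.isSeparable_of_perfectField
    exact isGalois_iff.2 ⟨inferInstance, hCnormal f⟩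
  have hCsolv : ∀ f, IsSolvable ((C f) ≃ₐ[↥k] (C f)) := fun f =>
    isSolvable_of_card_prime (p := ℓ) (by rw [IsGalois.card_aut_eq_finrank, hCrank])
  -- the compositum over `k` and over `K`
  haveI : Nonempty (MK →ₐ[K] AlgebraicClosure K) := ⟨MK.val⟩
  obtain ⟨hk₁'fin, hk₁'gal, hk₁'solv⟩ := finiteDimensional_isGalois_isSolvable_iSup C hCsolv
  set k₁' : IntermediateField (↥k) (AlgebraicClosure K) := ⨆ f, C f with hk₁'
  set k₁ : IntermediateField K (AlgebraicClosure K) := k₁'.restrictScalars K with hk₁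
  have hCres : ∀ f, (C f).restrictScalars K = f.fieldRange := fun f => by
    change MK.map ((absoluteGaloisGroup.toAlgEquiv K (γ f) :
      AlgebraicClosure K ≃ₐ[K] AlgebraicClosure K) : AlgebraicClosure K →ₐ[K] AlgebraicClosure K) =
      f.fieldRange
    rw [← IntermediateField.fieldRange_comp_val]
    congr 1
    ext m
    exact hγ f m
  have hk₁eq : k₁ = normalClosure K MK (AlgebraicClosure K) := by
    rw [hk₁, hk₁', restrictScalars_iSup, normalClosure_def]
    exact iSup_congr hCres
  haveI hk₁fin : FiniteDimensional K k₁ := by rw [hk₁eq]; infer_instance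
  haveI hk₁gal : IsGalois K k₁ := by rw [hk₁eq]; infer_instance
  have hsolv₁ : IsSolvable (k₁ ≃ₐ[K] k₁) := by
    haveI := hk₁'solv
    haveI : IsSolvable (k ≃ₐ[K] k) := hsolv
    exact isSolvable_algEquiv_restrictScalars k k₁'
  -- inclusions
  have hMk₁ : ∀ x : AlgebraicClosure K, x ∈ M → x ∈ k₁ := fun x hx => by
    rw [hk₁eq]
    exact IntermediateField.le_normalClosure MK hx
  have hkk₁ : k ≤ k₁ := fun x hx => hMk₁ x (IntermediateField.algebraMap_mem M (⟨x, hx⟩ : k))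
  -- splitting at `V`
  have hsplit₁ : ∀ u ∈ V, ∀ σ : absoluteGaloisGroup (u.adicCompletion K), ∀ x ∈ k₁,
      σ • absClosureEmbedding K (u.adicCompletion K) x =
        absClosureEmbedding K (u.adicCompletion K) x := by
    intro u hu σ x hx
    change x ∈ k₁' at hx
    rw [hk₁', ← (IntermediateField.gi (F := ↥k) (E := AlgebraicClosure K)).l_iSup_u] at hx
    refine forall_mem_adjoin_smul_eq K k _
      ((absClosureEmbedding K (u.adicCompletion K) : AlgebraicClosure K →+*
        AlgebraicClosure (u.adicCompletion K))) σ (hsplit u hu σ) (fun y hy => ?_) x hx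
    obtain ⟨f, hyf⟩ := Set.mem_iUnion.1 hy
    rw [SetLike.mem_coe] at hyf
    change y ∈ MK.map ((absoluteGaloisGroup.toAlgEquiv K (γ f) :
      AlgebraicClosure K ≃ₐ[K] AlgebraicClosure K) : AlgebraicClosure K →ₐ[K] AlgebraicClosure K)
      at hyf
    rw [IntermediateField.mem_map] at hyf
    obtain ⟨m, hm, rfl⟩ := hyf
    exact forall_smul_conj_eq_of_layer K u k hℓ hζg M hMle hMrank (hsplit u hu) (γ f)
      (hC3 u hu (γ f)) σ m hm
  -- total reality
  have hTR₁ : (∀ φ : K →+* ℂ, NumberField.ComplexEmbedding.IsReal φ) →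
      ∀ φ : k₁ →+* ℂ, NumberField.ComplexEmbedding.IsReal φ := by
    intro hK
    have hk' := hTR hK
    have hM : ∀ φ : M →+* ℂ, NumberField.ComplexEmbedding.IsReal φ := fun φ =>
      isReal_of_layer K k hℓ hζg M hMle hMsup hMrank hA hpos hk' φ
    have hC : ∀ f, ∀ φ : (C f) →+* ℂ, NumberField.ComplexEmbedding.IsReal φ := fun f =>
      isReal_map_of_isReal K MK _ hM
    have hC' : ∀ f, ∀ φ : ((C f).restrictScalars K) →+* ℂ,
        NumberField.ComplexEmbedding.IsReal φ := hC
    have h1 : ∀ φ : (⨆ f, (C f).restrictScalars K : IntermediateField K (AlgebraicClosure K)) →+* ℂ,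
        NumberField.ComplexEmbedding.IsReal φ := isReal_iSup K _ hK hC'
    rw [hk₁, hk₁', restrictScalars_iSup]
    exact h1
  -- the measure drops
  have hμ₁ : μ k₁ < μ k := by
    apply Finset.sum_lt_sum
    · intro v hv
      exact Subgroup.relIndex_le_of_le_right
        (fun σ hσ => (hHloc v k σ).2 fun x hx => (hHloc v k₁ σ).1 hσ x (hkk₁ hx)) (hfin v hv k)
    · refine ⟨v₀, hv₀, ?_⟩
      have hH'0 : (N v₀).relIndex H' ≠ 0 := fun h0 => hne (by rw [← hmeas, h0, zero_mul])
      have h1 : Hloc v₀ k₁ ≤ H' := fun σ hσ =>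
        (hH'mem σ).1 fun x hx => (hHloc v₀ k₁ σ).1 hσ x (hMk₁ x hx)
      have h2 : (N v₀).relIndex (Hloc v₀ k₁) ≤ (N v₀).relIndex H' :=
        Subgroup.relIndex_le_of_le_right h1 hH'0
      have h3 : (N v₀).relIndex H' < (N v₀).relIndex (Hloc v₀ k) := by
        rw [← hmeas]
        exact lt_mul_of_one_lt_right (Nat.pos_of_ne_zero hH'0) hℓ.one_lt
      exact h2.trans_lt h3
  exact ih (μ k₁) (hμ ▸ hμ₁) k₁ hsolv₁ hsplit₁ hTR₁ rfl

end Engine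

end Literature.NumberTheory.GaloisRepresentations
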